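import Summits.PneNP.PneNP.Theorems.ChebyshevTracialDesignBlockStatisticPricing
import Literature.Combinatorics.Optimization.ShellLawTypeBounds
import HarnessLib

/-!
# Cell pnp-psdrank, route `ChebyshevTracialDesign`: PER-MATCHING PRICING OF A BLOCK STATISTIC FROM THE `H`-TYPE OF THE MATCHING —
# the `x`-smoothness numbers of brick 117 discharged on the typical components (crux `TracialDecayExp20`, stmt-PneNP-19878)

Brick 118 (prover g21; MEMO-24 §2). Brick 117 (`designValue_blockStat_le`) prices `g(U) = ψ(|U ∩ H|)` at a matching `M` by an exact
design modulo the numbers `X_k = Σ_{x=0}^{t} |(∇²)^k law_{S′}(t−2k,·)(c)(x)|` of the `k`-fold two-edge-deleted ground sets `S′`. Lit g32's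
`ShellLawGeneratingPolynomial.sum_abs_nab2_iter_shellLaw_le_threshold` (half-set × level-`0` mixture of shifted hypergeometric rows +
`PoissonBinomialDifferences.hypergeometric_absCoeffSum_le`) bounds such a number by `(2√192·√(4k/V₀))^{2k} + 4^k·A` where `A` is the
normalised weight of the ATYPICAL components `(Y, α)` (here: `α + r₀ > s`, too many `HH` edges among the `s` full ones) and `V₀` a lower
bound for the hypergeometric variance of the typical ones; Literature `ShellLawTypeBounds.hypVar_component_ge` supplies
`V₀ = β⁴(b′+d′−2c)` from the `H`-type `(a′,b′,d′)` of `S′`, and `two_mul_reps_le_of_subset` / `reps_card_le_of_subset` relate the type of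
`S′` to the type `(a,b,d)` of `M` (`b − 2k ≤ b′ ≤ b`, `d − 2k ≤ d′ ≤ d`). Composing:

* §1 **`smoothnessNumber_le_of_type`** — for a `π`-stable `S′` whose type satisfies the `β`-margins, `X_k(S′, c+2s, c) ≤ (2√192·√(4k/V₀))^{2k} + 4^k·A_{r₀}(S′,c,s)`.
* §2 `type_margins_of_deleted` — the margins for every `k`-fold deleted `S′` (`k ≤ D+1`, level `c ≤ T`, `s ≤ t/2`) from four inequalities on
  the type of `M`; **`designValue_blockStat_le_of_type`** — THE PRICING FROM THE TYPE: for an exact design `(n, t = t′+2(D+1), T, D, B_v, C, w)`,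
  a matching `M` with `b` mixed and `d` `H̄H̄` edges satisfying `β(b+d) + T + 2(D+1) ≤ min(b,d)`, `β(b+d) ≤ r₀`,
  `t/2 + β(b+d) + 2T + 4(D+1) ≤ b + d`, `V₀ ≤ β⁴(b+d−4(D+1)−2T)`, `2(D+1) − 1 ≤ 2V₀`, and atypical weights `≤ μ` on all deleted ground sets:
  `|PM|·Σ_U W(U,M)·ψ(|U∩H|) ≤ −E_{Shell_1(M)}[ψ(|U∩H|)] + G·Σ_{k=1}^{D} (C(2k,k)/4^k)·ρ^k·X_k + B_v·C((T−1)/2,D+1)·G·ρ^{D+1}·X_{D+1}`,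
  `X_k = (2√192·√(4k/V₀))^{2k} + 4^k·μ`, `ρ = m/(4(m−2))`.
READING: for `|H| = n/2` and a typical `M` (`a ≈ d ≈ n/8`, `b ≈ n/4` as edge counts) all margins hold with `β ≍ 1/10`, `V₀ ≍ β⁴·n`; the main terms
are `(C k/(β⁴ n))^k` and the remainder `B_v·C(2√n,D+1)·G·(ρC(D+1)/(β⁴n))^{D+1}` is super-polynomially small; the atypical weight `μ` is lit g32's
hypergeometric `α`-tail (`RealRootedBernoulliSum` §5 `sum_Ico_hypergeomPMFReal_le`, `ShellLawGeneratingPolynomial` v3 `…_le_tail`: `≤ C(s,k′)·C(a,k′)/C(N′,k′)`,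
exponentially small for `r₀ ≍ βn`) — kept here as the ONE explicit hypothesis `hA`, discharged by name once v3 is in the tree. Matchings violating the
margins (`b` small: `H` ≈ union of edges; `a` or `d` small: `H` ≈ transversal — eng g20: the rough end) are eng's `2^{−βN}` tails (`…CrossingCountTails`).
WHAT THIS FILE DOES NOT DO: bound `μ` (lit v3), average over `M`, treat tilted masks, prove or refute `TracialDecayExp20`; nothing on psd rank or P vs NP.
[cite: Rothvoss2017, §2 (PDF p. 6)] [cite: RollinRoss2010, §3–§4.1] [cite: Agarwal2000DifferenceEquations, Remark 1.8.1 (1.8.8)] [cite: GriblingDelaatLaurent2019, §5]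
Stature: support/instrument (kernel lane, no defs, axioms standard). Supports stmt-PneNP-19878.
-/

set_option linter.dupNamespace false -- `Summit.PneNP.PneNP.…`: summit = sub-problem (D-0017)

noncomputable section

namespace Summit.PneNP.PneNP.Theorems.ChebyshevTracialDesignBlockStatisticPricingByType

open Finset Polynomial Literature.Barriers.PneNP Literature.Combinatorics.Optimization
open Literature.Combinatorics.Optimization.ShellStep
open Summit.PneNP.PneNP.Theorems.ChebyshevTracialDesignBlockStatisticPricing (designValue_blockStat_le rho_nonneg)

variable {n : ℕ}

/-! ### §1 The smoothness number of a ground set of good type -/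

/-- **`X_k` from the type (typical components) plus the atypical weight.** For a `π`-stable `S′` with `b′` mixed and `d′` `H̄H̄`
edges, level `c`, `s` full edges, threshold `r₀`, `β > 0` and `0 < V₀ ≤ β⁴(b′+d′−2c)` with the margins of `hypVar_component_ge` and
`2k − 1 ≤ 2V₀`: `Σ_{x∈win} |(∇²)^k law_{S′}(c+2s,·)(c)(x)| ≤ (2√192·√(4k/V₀))^{2k} + 4^k·A_{r₀}(S′,c,s)`, `A` the normalised weight of the components
with `α + r₀ > s`. [cite: Rothvoss2017, §2 (PDF p. 6)] [cite: RollinRoss2010, §4.1 Thm 4.2] -/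
theorem smoothnessNumber_le_of_type {π : Fin n → Fin n} (hπ : ∀ v, π (π v) = v) (hπ' : ∀ v, π v ≠ v)
    {S' : Finset (Fin n)} (hS' : ∀ v ∈ S', π v ∈ S') (H : Finset (Fin n)) (c s k r₀ : ℕ) (win : Finset ℤ)
    {β V₀ : ℝ} (hβ : 0 < β) (hV₀ : 0 < V₀) (hk : (2 * k : ℝ) - 1 ≤ 2 * V₀)
    (hV₀le : V₀ ≤ β ^ 4 * ((((reps π (vBH π S' H ∪ vBN π S' H)).card : ℝ) + (reps π (vDD π S' H)).card) - 2 * c))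
    (hb : β * (((reps π (vBH π S' H ∪ vBN π S' H)).card : ℝ) + (reps π (vDD π S' H)).card) + c ≤
      (reps π (vBH π S' H ∪ vBN π S' H)).card)
    (hd : β * (((reps π (vBH π S' H ∪ vBN π S' H)).card : ℝ) + (reps π (vDD π S' H)).card) + c ≤
      (reps π (vDD π S' H)).card)
    (hr₀ : β * (((reps π (vBH π S' H ∪ vBN π S' H)).card : ℝ) + (reps π (vDD π S' H)).card) ≤ r₀)
    (hs : (s : ℝ) + β * (((reps π (vBH π S' H ∪ vBN π S' H)).card : ℝ) + (reps π (vDD π S' H)).card) + 2 * c ≤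
      ((reps π (vBH π S' H ∪ vBN π S' H)).card : ℝ) + (reps π (vDD π S' H)).card)
    (h2 : 2 + 2 * c ≤ (reps π (vBH π S' H ∪ vBN π S' H)).card + (reps π (vDD π S' H)).card) :
    ∑ x ∈ win, |nab2^[k] (fun c' x => shellLaw π S' H (c + 2 * s) c' x : Profile) c x| ≤
      (2 * Real.sqrt 192 * Real.sqrt (4 * k / V₀)) ^ (2 * k) +
        (4 : ℝ) ^ k * ((1 / ((shellIn π S' (c + 2 * s) c).card : ℝ)) *
          ∑ Y ∈ halfSets π S' c, ∑ α ∈ range (s + 1),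
            if α + r₀ ≤ s then 0 else
              (((reps π (vAA π (strip π S' Y) H)).card.choose α : ℕ) : ℝ) *
                ((((reps π (vBH π (strip π S' Y) H ∪ vBN π (strip π S' Y) H)).card +
                  (reps π (vDD π (strip π S' Y) H)).card).choose (s - α) : ℕ) : ℝ)) :=
  sum_abs_nab2_iter_shellLaw_le_threshold hπ hπ' hS' H c s k win hV₀ hk (fun _ α => α + r₀ ≤ s)
    fun Y hY α hα hT => hV₀le.trans (hypVar_component_ge hπ hπ' hS' H c s r₀ hβ hb hd hr₀ hs h2 Y hY α hα hT)

/-! ### §2 The per-matching pricing from the type of the matching -/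

/-- **Type margins of the deleted ground sets from the type of the matching.** If `S′ ⊆ univ` is `π`-stable with
`|S′| + 4k = n`, `k ≤ D+1`, the level `c + 2 ≤ T` and `s ≤ t/2`, then the four margins of `M`'s type (`b` mixed, `d` `H̄H̄` edges)
`β(b+d) + T + 2(D+1) ≤ min(b,d)`, `β(b+d) ≤ r₀`, `t/2 + β(b+d) + 2T + 4(D+1) ≤ b + d`, `V₀ ≤ β⁴(b+d−4(D+1)−2T)` give the margins of
`smoothnessNumber_le_of_type` for `S′`. [cite: Rothvoss2017, §2 (PDF p. 5)] -/
theorem type_margins_of_deleted {π : Fin n → Fin n} (hπ : ∀ v, π (π v) = v) (hπ' : ∀ v, π v ≠ v) (H : Finset (Fin n))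
    {S' : Finset (Fin n)} (hS' : ∀ v ∈ S', π v ∈ S') {k D T c s t : ℕ} (hcard : S'.card + 4 * k = n) (hkD : k ≤ D + 1)
    (hcT : c + 2 ≤ T) (hst : 2 * s ≤ t) {β V₀ : ℝ} (hβ : 0 < β) (r₀ : ℕ)
    (hbT : β * (((reps π (vBH π univ H ∪ vBN π univ H)).card : ℝ) + (reps π (vDD π univ H)).card) + T + 2 * (D + 1) ≤
      (reps π (vBH π univ H ∪ vBN π univ H)).card)
    (hdT : β * (((reps π (vBH π univ H ∪ vBN π univ H)).card : ℝ) + (reps π (vDD π univ H)).card) + T + 2 * (D + 1) ≤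
      (reps π (vDD π univ H)).card)
    (hr₀ : β * (((reps π (vBH π univ H ∪ vBN π univ H)).card : ℝ) + (reps π (vDD π univ H)).card) ≤ r₀)
    (hsT : (t : ℝ) / 2 + β * (((reps π (vBH π univ H ∪ vBN π univ H)).card : ℝ) + (reps π (vDD π univ H)).card) +
      2 * T + 4 * (D + 1) ≤ ((reps π (vBH π univ H ∪ vBN π univ H)).card : ℝ) + (reps π (vDD π univ H)).card)
    (hV₀le : V₀ ≤ β ^ 4 * ((((reps π (vBH π univ H ∪ vBN π univ H)).card : ℝ) + (reps π (vDD π univ H)).card) -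
      4 * (D + 1) - 2 * T)) :
    V₀ ≤ β ^ 4 * ((((reps π (vBH π S' H ∪ vBN π S' H)).card : ℝ) + (reps π (vDD π S' H)).card) - 2 * c) ∧
    β * (((reps π (vBH π S' H ∪ vBN π S' H)).card : ℝ) + (reps π (vDD π S' H)).card) + c ≤
      (reps π (vBH π S' H ∪ vBN π S' H)).card ∧
    β * (((reps π (vBH π S' H ∪ vBN π S' H)).card : ℝ) + (reps π (vDD π S' H)).card) + c ≤
      (reps π (vDD π S' H)).card ∧
    β * (((reps π (vBH π S' H ∪ vBN π S' H)).card : ℝ) + (reps π (vDD π S' H)).card) ≤ r₀ ∧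
    (s : ℝ) + β * (((reps π (vBH π S' H ∪ vBN π S' H)).card : ℝ) + (reps π (vDD π S' H)).card) + 2 * c ≤
      ((reps π (vBH π S' H ∪ vBN π S' H)).card : ℝ) + (reps π (vDD π S' H)).card ∧
    2 + 2 * c ≤ (reps π (vBH π S' H ∪ vBN π S' H)).card + (reps π (vDD π S' H)).card := by
  set b := (reps π (vBH π univ H ∪ vBN π univ H)).card with hbdef
  set d := (reps π (vDD π univ H)).card with hddef
  set b' := (reps π (vBH π S' H ∪ vBN π S' H)).card with hb'def
  set d' := (reps π (vDD π S' H)).card with hd'def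
  -- `b − 2k ≤ b′ ≤ b`, `d − 2k ≤ d′ ≤ d`
  obtain ⟨_, hbge, hdge⟩ := two_mul_reps_le_of_subset hπ hπ' (S := univ) (S' := S') (fun v _ => mem_univ _) hS' H
  obtain ⟨_, hble, hdle⟩ := reps_card_le_of_subset (π := π) (S := univ) (S' := S') (subset_univ _) H
  rw [← hbdef, ← hb'def] at hbge hble
  rw [← hddef, ← hd'def] at hdge hdle
  have hdiff : (univ \ S').card = 4 * k := by
    rw [card_sdiff, inter_eq_left.2 (subset_univ _), card_univ, Fintype.card_fin]; omega
  rw [hdiff] at hbge hdge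
  have hbge' : (b : ℝ) ≤ b' + 2 * (D + 1) := by
    have : b ≤ b' + 2 * k := by omega
    have : (b : ℝ) ≤ b' + 2 * k := by exact_mod_cast this
    have hk' : (k : ℝ) ≤ D + 1 := by exact_mod_cast hkD
    linarith
  have hdge' : (d : ℝ) ≤ d' + 2 * (D + 1) := by
    have : d ≤ d' + 2 * k := by omega
    have : (d : ℝ) ≤ d' + 2 * k := by exact_mod_cast this
    have hk' : (k : ℝ) ≤ D + 1 := by exact_mod_cast hkD
    linarith
  have hble' : (b' : ℝ) ≤ b := by exact_mod_cast hble
  have hdle' : (d' : ℝ) ≤ d := by exact_mod_cast hdle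
  have hcT' : (c : ℝ) + 2 ≤ T := by exact_mod_cast hcT
  have hst' : (s : ℝ) ≤ (t : ℝ) / 2 := by
    have : ((2 * s : ℕ) : ℝ) ≤ t := by exact_mod_cast hst
    push_cast at this; linarith
  have hβm : β * ((b' : ℝ) + d') ≤ β * ((b : ℝ) + d) := mul_le_mul_of_nonneg_left (by linarith) hβ.le
  have hβ4 : 0 ≤ β ^ 4 := by positivity
  refine ⟨?_, by linarith, by linarith, by linarith, by linarith, ?_⟩
  · refine hV₀le.trans (mul_le_mul_of_nonneg_left (by linarith) hβ4)
  · have : (2 : ℝ) + 2 * c ≤ (b' : ℝ) + d' := by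
      have hβbd : 0 ≤ β * ((b : ℝ) + d) := by positivity
      have ht0 : (0 : ℝ) ≤ (t : ℝ) / 2 := by positivity
      linarith
    exact_mod_cast this

/-- An exact design has a level, so `T ≥ 3`. [cite: Rothvoss2017, §2 (PDF p. 6, eq. (2))] -/
theorem three_le_top {t T D : ℕ} {Bv : ℝ} {C : Finset ℕ} {w : ℕ → ℝ} (hdes : IsExactDesign n t T D Bv C w) : 3 ≤ T := by
  have hC : C.Nonempty := by
    by_contra h
    rw [not_nonempty_iff_eq_empty] at h
    have := hdes.2.2.2.2.1
    rw [h, sum_empty] at this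
    exact zero_ne_one this
  obtain ⟨c, hc⟩ := hC
  have h := hdes.2.2.2.1 c hc
  exact h.2.1.trans h.2.2.1

/-- **PER-MATCHING PRICING OF A BLOCK STATISTIC FROM THE TYPE OF THE MATCHING (brick 118).** For an exact design
`(n, t = t′+2(D+1), T, D, B_v, C, w)`, a matching `M` whose `H`-type (`b` mixed edges, `d` `H̄H̄` edges — as `reps` counts on `univ`) satisfies the
margins `β(b+d) + T + 2(D+1) ≤ min(b,d)`, `β(b+d) ≤ r₀`, `t/2 + β(b+d) + 2T + 4(D+1) ≤ b + d`, a variance floor `0 < V₀ ≤ β⁴(b+d−4(D+1)−2T)` with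
`2(D+1) − 1 ≤ 2V₀`, a profile `|ψ| ≤ G` on `[0,t]`, `m ≥ 3` with `m + 4(D+1) ≤ n`, and a bound `μ` on the atypical weights of all `k`-fold deleted
ground sets (`k ≤ D+1`, odd levels `c ≤ T`): `|PM|·Σ_U W(U,M)·ψ(|U∩H|) ≤ −E_{Shell_1(M)}[ψ(|U∩H|)] + G·Σ_{k=1}^{D}(C(2k,k)/4^k)·ρ^k·X_k
+ B_v·C((T−1)/2,D+1)·G·ρ^{D+1}·X_{D+1}`, `X_k = (2√192·√(4k/V₀))^{2k} + 4^k·μ`, `ρ = m/(4(m−2))`.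
[cite: Rothvoss2017, §2 (PDF p. 6)] [cite: RollinRoss2010, §4.1 Thm 4.2] [cite: Agarwal2000DifferenceEquations, Remark 1.8.1 (1.8.8)]
[cite: GriblingDelaatLaurent2019, §5] -/
theorem designValue_blockStat_le_of_type {t' T D : ℕ} {Bv : ℝ} {C : Finset ℕ} {w : ℕ → ℝ}
    (hdes : IsExactDesign n (t' + 2 * (D + 1)) T D Bv C w) (M : PMatch n) (H : Finset (Fin n)) (ψ : ℤ → ℝ)
    {G : ℝ} (hG0 : 0 ≤ G) (hG : ∀ x ∈ Icc (0 : ℤ) ((t' + 2 * (D + 1) : ℕ) : ℤ), |ψ x| ≤ G)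
    {m : ℕ} (hm : 3 ≤ m) (hmn : m + 4 * (D + 1) ≤ n) {β V₀ μ : ℝ} (hβ : 0 < β) (hV₀ : 0 < V₀) (hμ0 : 0 ≤ μ) (r₀ : ℕ)
    (hkV : (2 * (D + 1 : ℕ) : ℝ) - 1 ≤ 2 * V₀)
    (hbT : β * (((reps M.2.partner (vBH M.2.partner univ H ∪ vBN M.2.partner univ H)).card : ℝ) +
      (reps M.2.partner (vDD M.2.partner univ H)).card) + T + 2 * (D + 1) ≤
      (reps M.2.partner (vBH M.2.partner univ H ∪ vBN M.2.partner univ H)).card)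
    (hdT : β * (((reps M.2.partner (vBH M.2.partner univ H ∪ vBN M.2.partner univ H)).card : ℝ) +
      (reps M.2.partner (vDD M.2.partner univ H)).card) + T + 2 * (D + 1) ≤
      (reps M.2.partner (vDD M.2.partner univ H)).card)
    (hr₀ : β * (((reps M.2.partner (vBH M.2.partner univ H ∪ vBN M.2.partner univ H)).card : ℝ) +
      (reps M.2.partner (vDD M.2.partner univ H)).card) ≤ r₀)
    (hsT : ((t' + 2 * (D + 1) : ℕ) : ℝ) / 2 +
      β * (((reps M.2.partner (vBH M.2.partner univ H ∪ vBN M.2.partner univ H)).card : ℝ) +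
        (reps M.2.partner (vDD M.2.partner univ H)).card) + 2 * T + 4 * (D + 1) ≤
      ((reps M.2.partner (vBH M.2.partner univ H ∪ vBN M.2.partner univ H)).card : ℝ) +
        (reps M.2.partner (vDD M.2.partner univ H)).card)
    (hV₀le : V₀ ≤ β ^ 4 * ((((reps M.2.partner (vBH M.2.partner univ H ∪ vBN M.2.partner univ H)).card : ℝ) +
      (reps M.2.partner (vDD M.2.partner univ H)).card) - 4 * (D + 1) - 2 * T))
    (hA : ∀ k : ℕ, 1 ≤ k → k ≤ D + 1 → ∀ S' : Finset (Fin n), (∀ v ∈ S', M.2.partner v ∈ S') → S'.card + 4 * k = n →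
      ∀ c s : ℕ, c ≤ T → c + 2 * s + 2 * k = t' + 2 * (D + 1) →
      (1 / ((shellIn M.2.partner S' (c + 2 * s) c).card : ℝ)) *
          ∑ Y ∈ halfSets M.2.partner S' c, ∑ α ∈ range (s + 1),
            (if α + r₀ ≤ s then 0 else
              (((reps M.2.partner (vAA M.2.partner (strip M.2.partner S' Y) H)).card.choose α : ℕ) : ℝ) *
                ((((reps M.2.partner (vBH M.2.partner (strip M.2.partner S' Y) H ∪ vBN M.2.partner (strip M.2.partner S' Y) H)).card +
                  (reps M.2.partner (vDD M.2.partner (strip M.2.partner S' Y) H)).card).choose (s - α) : ℕ) : ℝ)) ≤ μ) :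
    (Fintype.card (PMatch n) : ℝ) * ∑ U : OddSet n, levelWeight n (t' + 2 * (D + 1)) C w U M * ψ ((U.1 ∩ H).card : ℤ) ≤
      -((∑ U' ∈ shell M.2.partner (t' + 2 * (D + 1)) 1, ψ ((U' ∩ H).card : ℤ)) /
          ((shell M.2.partner (t' + 2 * (D + 1)) 1).card : ℝ)) +
        G * ∑ k ∈ Icc 1 D, (((2 * k).choose k : ℕ) : ℝ) / (4 : ℝ) ^ k *
          ((((m : ℝ) / (4 * ((m : ℝ) - 2))) ^ k) * ((2 * Real.sqrt 192 * Real.sqrt (4 * k / V₀)) ^ (2 * k) + (4 : ℝ) ^ k * μ)) +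
        Bv * ((((T - 1) / 2).choose (D + 1) : ℕ) : ℝ) *
          (G * (((m : ℝ) / (4 * ((m : ℝ) - 2))) ^ (D + 1) *
            ((2 * Real.sqrt 192 * Real.sqrt (4 * (D + 1 : ℕ) / V₀)) ^ (2 * (D + 1)) + (4 : ℝ) ^ (D + 1) * μ))) := by
  set π := M.2.partner with hπdef
  have hπ : ∀ v, π (π v) = v := partner_partner M
  have hπ' : ∀ v, π v ≠ v := partner_ne M
  have ht : Odd (t' + 2 * (D + 1)) := hdes.1
  have hT3 : 3 ≤ T := three_le_top hdes
  have hTt : T ≤ t' + 2 * (D + 1) := hdes.2.2.1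
  -- the smoothness numbers
  set X : ℕ → ℝ := fun k => (2 * Real.sqrt 192 * Real.sqrt (4 * k / V₀)) ^ (2 * k) + (4 : ℝ) ^ k * μ with hX
  have hX0 : ∀ k, 0 ≤ X k := fun k => by positivity
  -- the generic discharge: a `k`-fold deleted `S′`, a level `c` with `c + 2 ≤ T`, `c + 2s + 2k = t`
  have hdis : ∀ k : ℕ, 1 ≤ k → k ≤ D + 1 → ∀ S' : Finset (Fin n), (∀ v ∈ S', π v ∈ S') → S'.card + 4 * k = n →
      ∀ c s : ℕ, c + 2 ≤ T → c + 2 * s + 2 * k = t' + 2 * (D + 1) →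
      ∑ x ∈ Icc (0 : ℤ) ((t' + 2 * (D + 1) : ℕ) : ℤ),
        |nab2^[k] (fun c' x => shellLaw π S' H (c + 2 * s) c' x : Profile) c x| ≤ X k := by
    intro k hk1 hkD S' hS' hcard c s hcT hcs
    have hk : (2 * k : ℝ) - 1 ≤ 2 * V₀ := by
      have : (k : ℝ) ≤ (D + 1 : ℕ) := by exact_mod_cast hkD
      push_cast at this hkV ⊢; linarith
    obtain ⟨h1, h2, h3, h4, h5, h6⟩ := type_margins_of_deleted hπ hπ' H hS' hcard hkD hcT
      (t := t' + 2 * (D + 1)) (s := s) (by omega) hβ r₀ hbT hdT hr₀ hsT hV₀le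
    refine (smoothnessNumber_le_of_type hπ hπ' hS' H c s k r₀ _ hβ hV₀ hk h1 h2 h3 h4 h5 h6).trans ?_
    exact add_le_add le_rfl (mul_le_mul_of_nonneg_left (hA k hk1 hkD S' hS' hcard c s (by omega) hcs) (by positivity))
  refine designValue_blockStat_le hdes M H ψ hG0 hG hm hmn X hX0 ?_ ?_
  · -- base level `1`, orders `k ≤ D`
    intro k hk1 hkD S' hS' hcard
    obtain ⟨i, hi⟩ := ht
    have hik : k ≤ i := by omega
    have hs : 1 + 2 * (i - k) + 2 * k = t' + 2 * (D + 1) := by omega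
    have h := hdis k hk1 (by omega) S' hS' hcard 1 (i - k) (by omega) hs
    have e : t' + 2 * (D + 1) - 2 * k = 1 + 2 * (i - k) := by omega
    rw [e]
    exact h
  · -- order `D + 1`, odd base levels `c` with `c + 2(D+1) ≤ T`
    intro c hc hcT S' hS' hcard
    obtain ⟨j, rfl⟩ := hc
    obtain ⟨i, hi⟩ := ht
    have hij : j + (D + 1) ≤ i := by omega
    have hs : (2 * j + 1) + 2 * (i - j - (D + 1)) + 2 * (D + 1) = t' + 2 * (D + 1) := by omega
    have h := hdis (D + 1) (by omega) le_rfl S' hS' hcard (2 * j + 1) (i - j - (D + 1)) (by omega) hs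
    have e : t' = 2 * j + 1 + 2 * (i - j - (D + 1)) := by omega
    rw [e] at h ⊢
    exact h

/-! ### §3 The atypical weight by lit's hypergeometric `α`-tail: hypotheses on the type of `M` only -/

/-- **`X_k` from the type, with the atypical weight bounded by the binomial-moment tail** (lit g32's
`sum_abs_nab2_iter_shellLaw_le_tail`): under the margins of `smoothnessNumber_le_of_type` and `1 ≤ r₀`,
`X_k(S′,c+2s,c) ≤ (2√192·√(4k/V₀))^{2k} + 4^k·C(s,s+1−r₀)·C(a′,s+1−r₀)/C(|S′|/2−c,s+1−r₀)`, `a′` the number of `HH` edges of `S′`.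
[cite: Rothvoss2017, §2 (PDF p. 6)] [cite: RollinRoss2010, §4.1 Thm 4.2] -/
theorem smoothnessNumber_le_of_type_tail {π : Fin n → Fin n} (hπ : ∀ v, π (π v) = v) (hπ' : ∀ v, π v ≠ v)
    {S' : Finset (Fin n)} (hS' : ∀ v ∈ S', π v ∈ S') (H : Finset (Fin n)) (c s k r₀ : ℕ) (hr₀ : 1 ≤ r₀) (win : Finset ℤ)
    {β V₀ : ℝ} (hβ : 0 < β) (hV₀ : 0 < V₀) (hk : (2 * k : ℝ) - 1 ≤ 2 * V₀)
    (hV₀le : V₀ ≤ β ^ 4 * ((((reps π (vBH π S' H ∪ vBN π S' H)).card : ℝ) + (reps π (vDD π S' H)).card) - 2 * c))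
    (hb : β * (((reps π (vBH π S' H ∪ vBN π S' H)).card : ℝ) + (reps π (vDD π S' H)).card) + c ≤
      (reps π (vBH π S' H ∪ vBN π S' H)).card)
    (hd : β * (((reps π (vBH π S' H ∪ vBN π S' H)).card : ℝ) + (reps π (vDD π S' H)).card) + c ≤
      (reps π (vDD π S' H)).card)
    (hr₀' : β * (((reps π (vBH π S' H ∪ vBN π S' H)).card : ℝ) + (reps π (vDD π S' H)).card) ≤ r₀)
    (hs : (s : ℝ) + β * (((reps π (vBH π S' H ∪ vBN π S' H)).card : ℝ) + (reps π (vDD π S' H)).card) + 2 * c ≤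
      ((reps π (vBH π S' H ∪ vBN π S' H)).card : ℝ) + (reps π (vDD π S' H)).card)
    (h2 : 2 + 2 * c ≤ (reps π (vBH π S' H ∪ vBN π S' H)).card + (reps π (vDD π S' H)).card) :
    ∑ x ∈ win, |nab2^[k] (fun c' x => shellLaw π S' H (c + 2 * s) c' x : Profile) c x| ≤
      (2 * Real.sqrt 192 * Real.sqrt (4 * k / V₀)) ^ (2 * k) +
        (4 : ℝ) ^ k * ((s.choose (s + 1 - r₀) : ℝ) *
          (((reps π (vAA π S' H)).card.choose (s + 1 - r₀) : ℕ) : ℝ) /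
            (((S'.card / 2 - c).choose (s + 1 - r₀) : ℕ) : ℝ)) :=
  sum_abs_nab2_iter_shellLaw_le_tail hπ hπ' hS' H c s k r₀ hr₀ win hV₀ hk
    fun Y hY α hα hT => hV₀le.trans (hypVar_component_ge hπ hπ' hS' H c s r₀ hβ hb hd hr₀' hs h2 Y hY α hα hT)

/-- Monotonicity of the tail in the number of `HH` edges: `C(s,k′)·C(a′,k′)/C(N′,k′) ≤ C(s,k′)·C(a,k′)/C(N′,k′)` for `a′ ≤ a`.
[cite: Rothvoss2017, §2 (PDF p. 5)] -/
theorem tail_mono {s k' a' a N' : ℕ} (h : a' ≤ a) :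
    (s.choose k' : ℝ) * ((a'.choose k' : ℕ) : ℝ) / ((N'.choose k' : ℕ) : ℝ) ≤
      (s.choose k' : ℝ) * ((a.choose k' : ℕ) : ℝ) / ((N'.choose k' : ℕ) : ℝ) := by
  have h1 : ((a'.choose k' : ℕ) : ℝ) ≤ ((a.choose k' : ℕ) : ℝ) := by exact_mod_cast Nat.choose_le_choose k' h
  exact div_le_div_of_nonneg_right (mul_le_mul_of_nonneg_left h1 (by positivity)) (by positivity)

/-- **PER-MATCHING PRICING OF A BLOCK STATISTIC — HYPOTHESES ON THE TYPE OF THE MATCHING ONLY (brick 118b).** As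
`designValue_blockStat_le_of_type`, with the atypical weight discharged by lit g32's binomial-moment tail: the hypothesis `hμ` is now the
purely arithmetic `C(s, s+1−r₀)·C(a, s+1−r₀)/C((n−4k)/2−c, s+1−r₀) ≤ μ` for `1 ≤ k ≤ D+1`, `c + 2 ≤ T`, `c + 2s + 2k = t` (`a` = number of `HH`
edges of `M`; no deleted ground set appears). [cite: Rothvoss2017, §2 (PDF p. 6)] [cite: RollinRoss2010, §4.1 Thm 4.2]
[cite: Agarwal2000DifferenceEquations, Remark 1.8.1 (1.8.8)] [cite: GriblingDelaatLaurent2019, §5] -/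
theorem designValue_blockStat_le_of_type_tail {t' T D : ℕ} {Bv : ℝ} {C : Finset ℕ} {w : ℕ → ℝ}
    (hdes : IsExactDesign n (t' + 2 * (D + 1)) T D Bv C w) (M : PMatch n) (H : Finset (Fin n)) (ψ : ℤ → ℝ)
    {G : ℝ} (hG0 : 0 ≤ G) (hG : ∀ x ∈ Icc (0 : ℤ) ((t' + 2 * (D + 1) : ℕ) : ℤ), |ψ x| ≤ G)
    {m : ℕ} (hm : 3 ≤ m) (hmn : m + 4 * (D + 1) ≤ n) {β V₀ μ : ℝ} (hβ : 0 < β) (hV₀ : 0 < V₀) (hμ0 : 0 ≤ μ)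
    {r₀ : ℕ} (hr₀1 : 1 ≤ r₀) (hkV : (2 * (D + 1 : ℕ) : ℝ) - 1 ≤ 2 * V₀)
    (hbT : β * (((reps M.2.partner (vBH M.2.partner univ H ∪ vBN M.2.partner univ H)).card : ℝ) +
      (reps M.2.partner (vDD M.2.partner univ H)).card) + T + 2 * (D + 1) ≤
      (reps M.2.partner (vBH M.2.partner univ H ∪ vBN M.2.partner univ H)).card)
    (hdT : β * (((reps M.2.partner (vBH M.2.partner univ H ∪ vBN M.2.partner univ H)).card : ℝ) +
      (reps M.2.partner (vDD M.2.partner univ H)).card) + T + 2 * (D + 1) ≤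
      (reps M.2.partner (vDD M.2.partner univ H)).card)
    (hr₀ : β * (((reps M.2.partner (vBH M.2.partner univ H ∪ vBN M.2.partner univ H)).card : ℝ) +
      (reps M.2.partner (vDD M.2.partner univ H)).card) ≤ r₀)
    (hsT : ((t' + 2 * (D + 1) : ℕ) : ℝ) / 2 +
      β * (((reps M.2.partner (vBH M.2.partner univ H ∪ vBN M.2.partner univ H)).card : ℝ) +
        (reps M.2.partner (vDD M.2.partner univ H)).card) + 2 * T + 4 * (D + 1) ≤
      ((reps M.2.partner (vBH M.2.partner univ H ∪ vBN M.2.partner univ H)).card : ℝ) +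
        (reps M.2.partner (vDD M.2.partner univ H)).card)
    (hV₀le : V₀ ≤ β ^ 4 * ((((reps M.2.partner (vBH M.2.partner univ H ∪ vBN M.2.partner univ H)).card : ℝ) +
      (reps M.2.partner (vDD M.2.partner univ H)).card) - 4 * (D + 1) - 2 * T))
    (hμ : ∀ k c s : ℕ, 1 ≤ k → k ≤ D + 1 → c + 2 ≤ T → c + 2 * s + 2 * k = t' + 2 * (D + 1) →
      ((s.choose (s + 1 - r₀) : ℕ) : ℝ) *
          (((reps M.2.partner (vAA M.2.partner univ H)).card.choose (s + 1 - r₀) : ℕ) : ℝ) /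
            ((((n - 4 * k) / 2 - c).choose (s + 1 - r₀) : ℕ) : ℝ) ≤ μ) :
    (Fintype.card (PMatch n) : ℝ) * ∑ U : OddSet n, levelWeight n (t' + 2 * (D + 1)) C w U M * ψ ((U.1 ∩ H).card : ℤ) ≤
      -((∑ U' ∈ shell M.2.partner (t' + 2 * (D + 1)) 1, ψ ((U' ∩ H).card : ℤ)) /
          ((shell M.2.partner (t' + 2 * (D + 1)) 1).card : ℝ)) +
        G * ∑ k ∈ Icc 1 D, (((2 * k).choose k : ℕ) : ℝ) / (4 : ℝ) ^ k *
          ((((m : ℝ) / (4 * ((m : ℝ) - 2))) ^ k) * ((2 * Real.sqrt 192 * Real.sqrt (4 * k / V₀)) ^ (2 * k) + (4 : ℝ) ^ k * μ)) +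
        Bv * ((((T - 1) / 2).choose (D + 1) : ℕ) : ℝ) *
          (G * (((m : ℝ) / (4 * ((m : ℝ) - 2))) ^ (D + 1) *
            ((2 * Real.sqrt 192 * Real.sqrt (4 * (D + 1 : ℕ) / V₀)) ^ (2 * (D + 1)) + (4 : ℝ) ^ (D + 1) * μ))) := by
  set π := M.2.partner with hπdef
  have hπ : ∀ v, π (π v) = v := partner_partner M
  have hπ' : ∀ v, π v ≠ v := partner_ne M
  have ht : Odd (t' + 2 * (D + 1)) := hdes.1
  have hT3 : 3 ≤ T := three_le_top hdes
  have hTt : T ≤ t' + 2 * (D + 1) := hdes.2.2.1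
  set X : ℕ → ℝ := fun k => (2 * Real.sqrt 192 * Real.sqrt (4 * k / V₀)) ^ (2 * k) + (4 : ℝ) ^ k * μ with hX
  have hX0 : ∀ k, 0 ≤ X k := fun k => by positivity
  have hdis : ∀ k : ℕ, 1 ≤ k → k ≤ D + 1 → ∀ S' : Finset (Fin n), (∀ v ∈ S', π v ∈ S') → S'.card + 4 * k = n →
      ∀ c s : ℕ, c + 2 ≤ T → c + 2 * s + 2 * k = t' + 2 * (D + 1) →
      ∑ x ∈ Icc (0 : ℤ) ((t' + 2 * (D + 1) : ℕ) : ℤ),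
        |nab2^[k] (fun c' x => shellLaw π S' H (c + 2 * s) c' x : Profile) c x| ≤ X k := by
    intro k hk1 hkD S' hS' hcard c s hcT hcs
    have hk : (2 * k : ℝ) - 1 ≤ 2 * V₀ := by
      have : (k : ℝ) ≤ (D + 1 : ℕ) := by exact_mod_cast hkD
      push_cast at this hkV ⊢; linarith
    obtain ⟨h1, h2, h3, h4, h5, h6⟩ := type_margins_of_deleted hπ hπ' H hS' hcard hkD hcT
      (t := t' + 2 * (D + 1)) (s := s) (by omega) hβ r₀ hbT hdT hr₀ hsT hV₀le
    refine (smoothnessNumber_le_of_type_tail hπ hπ' hS' H c s k r₀ hr₀1 _ hβ hV₀ hk h1 h2 h3 h4 h5 h6).trans ?_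
    refine add_le_add le_rfl (mul_le_mul_of_nonneg_left ?_ (by positivity))
    obtain ⟨hale, _, _⟩ := reps_card_le_of_subset (π := π) (S := univ) (S' := S') (subset_univ _) H
    have hS'2 : S'.card / 2 - c = (n - 4 * k) / 2 - c := by
      rw [show S'.card = n - 4 * k by omega]
    rw [hS'2]
    exact (tail_mono hale).trans (hμ k c s hk1 hkD hcT hcs)
  refine designValue_blockStat_le hdes M H ψ hG0 hG hm hmn X hX0 ?_ ?_
  · intro k hk1 hkD S' hS' hcard
    obtain ⟨i, hi⟩ := ht
    have hik : k ≤ i := by omega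
    have hs : 1 + 2 * (i - k) + 2 * k = t' + 2 * (D + 1) := by omega
    have h := hdis k hk1 (by omega) S' hS' hcard 1 (i - k) (by omega) hs
    have e : t' + 2 * (D + 1) - 2 * k = 1 + 2 * (i - k) := by omega
    rw [e]
    exact h
  · intro c hc hcT S' hS' hcard
    obtain ⟨j, rfl⟩ := hc
    obtain ⟨i, hi⟩ := ht
    have hij : j + (D + 1) ≤ i := by omega
    have hs : (2 * j + 1) + 2 * (i - j - (D + 1)) + 2 * (D + 1) = t' + 2 * (D + 1) := by omega
    have h := hdis (D + 1) (by omega) le_rfl S' hS' hcard (2 * j + 1) (i - j - (D + 1)) (by omega) hs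
    have e : t' = 2 * j + 1 + 2 * (i - j - (D + 1)) := by omega
    rw [e] at h ⊢
    exact h

end Summit.PneNP.PneNP.Theorems.ChebyshevTracialDesignBlockStatisticPricingByType

end
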